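import Mathlib
import HarnessLib
import Summits.RiemannHypothesis.RiemannHypothesis.Theorems.WeilParityEvenWinsBeyondArchFrontier67
import Summits.RiemannHypothesis.RiemannHypothesis.Theorems.PfPersistenceParityTransport

/-!
# PF persistence — certified cell chains: the discrete, RH-free transport of the parity order

pub-rhpf (mechanism / rigidity campaign; **no RH claims**), unit transport-1 gen 3, TRANSPORT.md §10
(T-CELL).  Helper for item stmt-RiemannHypothesis-18085 (`NoParityCrossing`) and its by-name
companions stmt-1526 (`GroundStateSimpleEven`) / stmt-15432 (`EvenWinsBeyondArch`).

The continuous transport candidates of TRANSPORT.md §4 (Grönwall on the bottom, on the splitting, on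
the parity ratio) all need a RATE input that is not in the tree.  The tree's own certified machinery
already contains a DISCRETE transport with no rate input at all: the cell transfer
`GroundStateSimpleEven.weilWindowSimpleEven_on_cell_of_le` (an upper bound `ε(b) ≤ U` at the left end
and a certified odd-sector lower bound `L > U` at the right end give the window clause on the whole
cell `[b, c]`, by antitonicity of both sector bottoms).  This file records the chain form and the
frontier calculus it induces:

* `weilWindowSimpleEven_on_chain` (PROVED): a finite chain of windows `c 0 ≤ c 1 ≤ … ≤ c n` with
  upper data `ε(c k) ≤ U k`, odd lower data `L (k+1)` at `c (k+1)` and the STRICT BUDGET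
  `U k < L (k+1)` on every cell gives `WeilWindowSimpleEven a` for every `a ∈ [c 0, c n]`;
* frontier calculus (PROVED): if the window clause holds on `(0, T]` with `T ≥ 2/3` ("frontier at
  `T`"), then `NoParityCrossing ↔ no parity tie beyond T`, `GroundStateSimpleEven ↔ the same`, and no
  tie beyond `T` gives `EvenWinsBeyondArch` (`noParityCrossing_iff_beyond_frontier`, …); a chain
  anchored at `c 0 ≤ 2/3` moves the landed frontier `2/3` (Frontier67) to its top `c n`
  (`frontier_of_chain`);
* quantitative top (PROVED): at the top of a chain the splitting is at least the last budget,
  `L (m+1) − U m ≤ ε_od(c (m+1)) − ε_ev(c (m+1))` (`splitting_ge_budget_at_top`) — the re-anchored seed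
  for the continuous parity transport T-P (`PfPersistenceParityTransport`), whose leakage input may
  therefore start at any certified frontier `T` instead of `2/3`
  (`parity_of_frontier_of_splittingLeakageFrom`).

What this is NOT: a proof of any item — each cell needs an L-certificate (an odd-sector coercivity
bound at its right end), and the number of cells needed to reach a window `A` grows like
`∫ (8π e^{2a} − m⁺(a)) / (S(a) ln 10) da` (TRANSPORT.md §10, DERIVED reach law; DATA `S ≈ 1.5 + 1.9a`
decades of parity splitting): the chain is a finite-range instrument, the RH-free counterpart of the
rate hypotheses, not a route to the summit.  No definitions, no named facts, no `sorry`.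

References: E. Bombieri, Rend. Mat. Acc. Lincei (9) 11 (2000) 183–233, §4 (Problem 2, parity of
minimisers); A. Connes, C. Consani, H. Moscovici, arXiv:2511.22755, §6–§8 (evenness and simplicity of
the prolate ground state; the missing step 1 of §8).
-/

set_option linter.dupNamespace false

noncomputable section

open Set MeasureTheory

namespace Summit.RiemannHypothesis.RiemannHypothesis.Theorems.PfPersistenceCellChain

open Literature.NumberTheory.LFunctions
open Summit.RiemannHypothesis.RiemannHypothesis.Theses.WeilParity (NoParityCrossing EvenWinsBeyondArch)
open Summit.RiemannHypothesis.RiemannHypothesis.Theses.WeilGroundState (GroundStateSimpleEven)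
open Summit.RiemannHypothesis.RiemannHypothesis.Theorems.EvenWinsBeyondArch
open Summit.RiemannHypothesis.RiemannHypothesis.Theorems.GroundStateSimpleEven
  (weilWindowSimpleEven_on_cell_of_le weilGroundEnergy_le_of_trial
    groundStateSimpleEven_iff_noParityCrossing)
open Summit.RiemannHypothesis.RiemannHypothesis.Theorems.PfPersistenceParityTransport
  (splitting_pos_of_diniLeakageFrom)

/-! ## 1. Chains of certified cells -/

/-- In a chain `c k ≤ c (k+1)` (`k < n`) the windows do not decrease: `c 0 ≤ c k` for `k ≤ n`.
[folklore] -/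
theorem chain_head_le {c : ℕ → ℝ} {n : ℕ} (hmono : ∀ k, k < n → c k ≤ c (k + 1)) :
    ∀ k, k ≤ n → c 0 ≤ c k := by
  intro k hk
  induction k with
  | zero => exact le_rfl
  | succ m ih => exact (ih (Nat.le_of_succ_le hk)).trans (hmono m (Nat.lt_of_succ_le hk))

/-- Auxiliary form of `weilWindowSimpleEven_on_chain` with the chain length universally quantified
(for the induction). [folklore] -/
theorem weilWindowSimpleEven_on_chain_aux (c U L : ℕ → ℝ) :
    ∀ n : ℕ, 0 < n → 0 < c 0 → (∀ k, k < n → c k ≤ c (k + 1)) →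
      (∀ k, k < n → weilGroundEnergy (c k) ≤ U k) →
      (∀ k, k < n → ∀ g : ℝ → ℂ, IsWeilTest g →
        tsupport g ⊆ Icc (-(c (k + 1))) (c (k + 1)) → ∫ t, ‖g t‖ ^ 2 = (1 : ℝ) →
        (∀ t, g (-t) = -g t) → L (k + 1) ≤ (weilQuadratic g).re) →
      (∀ k, k < n → U k < L (k + 1)) →
      ∀ a : ℝ, c 0 ≤ a → a ≤ c n → WeilWindowSimpleEven a := by
  intro n
  induction n with
  | zero => intro hn; exact absurd hn (lt_irrefl 0)
  | succ m ih =>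
    intro _ h0 hmono hU hL hUL a ha hb
    rcases le_or_gt a (c m) with hle | hlt
    · rcases Nat.eq_zero_or_pos m with hm | hm
      · subst hm
        exact weilWindowSimpleEven_on_cell_of_le h0 (hUL 0 (Nat.lt_succ_self 0))
          (hU 0 (Nat.lt_succ_self 0)) (hL 0 (Nat.lt_succ_self 0)) ha hb
      · exact ih hm h0 (fun k hk ↦ hmono k (Nat.lt_succ_of_lt hk))
          (fun k hk ↦ hU k (Nat.lt_succ_of_lt hk)) (fun k hk ↦ hL k (Nat.lt_succ_of_lt hk))
          (fun k hk ↦ hUL k (Nat.lt_succ_of_lt hk)) a ha hle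
    · have hpos : 0 < c m := h0.trans_le (chain_head_le hmono m (Nat.le_succ m))
      exact weilWindowSimpleEven_on_cell_of_le hpos (hUL m (Nat.lt_succ_self m))
        (hU m (Nat.lt_succ_self m)) (hL m (Nat.lt_succ_self m)) hlt.le hb

/-- **Chain of certified cells ⟹ the window clause on the whole range.**  Let
`0 < c 0 ≤ c 1 ≤ … ≤ c n` (`n ≥ 1`) be windows with, on every cell `[c k, c (k+1)]`, an upper bound
`ε(c k) ≤ U k`, a certified lower bound `L (k+1)` for the `L²`-normalised ODD window-`c (k+1)` test
functions, and the strict budget `U k < L (k+1)`.  Then `WeilWindowSimpleEven a` (simple, isolated,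
even bottom) holds for every `a ∈ [c 0, c n]` — `weilWindowSimpleEven_on_cell_of_le` on the cell
containing `a`.  No continuity in the window and no rate input is used. [folklore] -/
theorem weilWindowSimpleEven_on_chain {c U L : ℕ → ℝ} {n : ℕ} (hn : 0 < n) (h0 : 0 < c 0)
    (hmono : ∀ k, k < n → c k ≤ c (k + 1))
    (hU : ∀ k, k < n → weilGroundEnergy (c k) ≤ U k)
    (hL : ∀ k, k < n → ∀ g : ℝ → ℂ, IsWeilTest g →
      tsupport g ⊆ Icc (-(c (k + 1))) (c (k + 1)) → ∫ t, ‖g t‖ ^ 2 = (1 : ℝ) →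
      (∀ t, g (-t) = -g t) → L (k + 1) ≤ (weilQuadratic g).re)
    (hUL : ∀ k, k < n → U k < L (k + 1)) {a : ℝ} (ha : c 0 ≤ a) (hb : a ≤ c n) :
    WeilWindowSimpleEven a :=
  weilWindowSimpleEven_on_chain_aux c U L n hn h0 hmono hU hL hUL a ha hb

/-- **Chain of certified cells with trial functions as upper data.**  As
`weilWindowSimpleEven_on_chain`, the upper datum of cell `k` being ONE `L²`-normalised window-`c k`
test function of energy `≤ U k` (`weilGroundEnergy_le_of_trial`). [folklore] -/
theorem weilWindowSimpleEven_on_chain_of_trials {c U L : ℕ → ℝ} {n : ℕ} (hn : 0 < n) (h0 : 0 < c 0)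
    (hmono : ∀ k, k < n → c k ≤ c (k + 1))
    (hU : ∀ k, k < n → ∃ e : ℝ → ℂ, IsWeilTest e ∧ tsupport e ⊆ Icc (-(c k)) (c k) ∧
      ∫ t, ‖e t‖ ^ 2 = (1 : ℝ) ∧ (weilQuadratic e).re ≤ U k)
    (hL : ∀ k, k < n → ∀ g : ℝ → ℂ, IsWeilTest g →
      tsupport g ⊆ Icc (-(c (k + 1))) (c (k + 1)) → ∫ t, ‖g t‖ ^ 2 = (1 : ℝ) →
      (∀ t, g (-t) = -g t) → L (k + 1) ≤ (weilQuadratic g).re)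
    (hUL : ∀ k, k < n → U k < L (k + 1)) {a : ℝ} (ha : c 0 ≤ a) (hb : a ≤ c n) :
    WeilWindowSimpleEven a := by
  refine weilWindowSimpleEven_on_chain hn h0 hmono (fun k hk ↦ ?_) hL hUL ha hb
  obtain ⟨e, he, hes, hen, heU⟩ := hU k hk
  exact weilGroundEnergy_le_of_trial he hes hen heU

/-! ## 2. Frontier calculus: the window clause on `(0, T]` -/

/-- Frontier at `T` ⟹ strict parity order `ε_ev < ε_od` on `(0, T]`. [folklore] -/
theorem lt_of_frontier {T : ℝ} (hT : ∀ a : ℝ, 0 < a → a ≤ T → WeilWindowSimpleEven a) {a : ℝ}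
    (ha : 0 < a) (hle : a ≤ T) : weilEvenGroundEnergy a < weilOddGroundEnergy a :=
  (weilWindowSimpleEven_iff_weilEvenGroundEnergy_lt ha).1 (hT a ha hle)

/-- Frontier at `T` and no parity tie beyond `T` ⟹ `NoParityCrossing` (item 18085). [folklore] -/
theorem noParityCrossing_of_beyond_frontier {T : ℝ}
    (hT : ∀ a : ℝ, 0 < a → a ≤ T → WeilWindowSimpleEven a)
    (h : ∀ a : ℝ, T < a → weilEvenGroundEnergy a ≠ weilOddGroundEnergy a) : NoParityCrossing := by
  intro a ha
  rcases le_or_gt a T with hle | hlt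
  · have ha0 : 0 < a := lt_trans (by positivity) ha
    exact ne_of_lt (lt_of_frontier hT ha0 hle)
  · exact h a hlt

/-- `NoParityCrossing` ⟹ no parity tie beyond any `T ≥ 2/3` (trivial restriction). [folklore] -/
theorem beyond_frontier_of_noParityCrossing {T : ℝ} (hT23 : 2 / 3 ≤ T) (h : NoParityCrossing) :
    ∀ a : ℝ, T < a → weilEvenGroundEnergy a ≠ weilOddGroundEnergy a :=
  fun a ha ↦ beyond_two_thirds_of_noParityCrossing h a (lt_of_le_of_lt hT23 ha)

/-- **Item 18085 from a frontier at `T ≥ 2/3`: `NoParityCrossing` ↔ no parity tie beyond `T`.**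
[folklore] -/
theorem noParityCrossing_iff_beyond_frontier {T : ℝ} (hT23 : 2 / 3 ≤ T)
    (hT : ∀ a : ℝ, 0 < a → a ≤ T → WeilWindowSimpleEven a) :
    NoParityCrossing ↔ ∀ a : ℝ, T < a → weilEvenGroundEnergy a ≠ weilOddGroundEnergy a :=
  ⟨beyond_frontier_of_noParityCrossing hT23, noParityCrossing_of_beyond_frontier hT⟩

/-- **Item 1526 from a frontier at `T ≥ 2/3`: `GroundStateSimpleEven` ↔ no parity tie beyond `T`.**
[folklore] -/
theorem groundStateSimpleEven_iff_beyond_frontier {T : ℝ} (hT23 : 2 / 3 ≤ T)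
    (hT : ∀ a : ℝ, 0 < a → a ≤ T → WeilWindowSimpleEven a) :
    GroundStateSimpleEven ↔ ∀ a : ℝ, T < a → weilEvenGroundEnergy a ≠ weilOddGroundEnergy a :=
  groundStateSimpleEven_iff_noParityCrossing.trans (noParityCrossing_iff_beyond_frontier hT23 hT)

/-- **Item 15432 from a frontier at `T`**: no parity tie beyond `T` ⟹ `EvenWinsBeyondArch`.
[folklore] -/
theorem evenWinsBeyondArch_of_noTie_beyond_frontier {T : ℝ}
    (hT : ∀ a : ℝ, 0 < a → a ≤ T → WeilWindowSimpleEven a)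
    (h : ∀ a : ℝ, T < a → weilEvenGroundEnergy a ≠ weilOddGroundEnergy a) : EvenWinsBeyondArch := by
  refine evenWinsBeyondArch_of_noTie_beyond_two_thirds fun a ha ↦ ?_
  rcases le_or_gt a T with hle | hlt
  · exact ne_of_lt (lt_of_frontier hT (lt_trans (by norm_num) ha) hle)
  · exact h a hlt

/-- **The three PF items from a frontier at `T ≥ 2/3` and no tie beyond `T`.** [folklore] -/
theorem parity_of_noTie_beyond_frontier {T : ℝ} (hT23 : 2 / 3 ≤ T)
    (hT : ∀ a : ℝ, 0 < a → a ≤ T → WeilWindowSimpleEven a)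
    (h : ∀ a : ℝ, T < a → weilEvenGroundEnergy a ≠ weilOddGroundEnergy a) :
    NoParityCrossing ∧ GroundStateSimpleEven ∧ EvenWinsBeyondArch :=
  ⟨noParityCrossing_of_beyond_frontier hT h, (groundStateSimpleEven_iff_beyond_frontier hT23 hT).2 h,
    evenWinsBeyondArch_of_noTie_beyond_frontier hT h⟩

/-! ## 3. A chain anchored at or below `2/3` moves the frontier to its top -/

/-- **Frontier shift by a chain.**  A certified chain with `0 < c 0 ≤ 2/3` (so that the landed
frontier `2/3` of `weilWindowSimpleEven_of_le_two_thirds` covers `(0, c 0]`) moves the frontier to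
its top: the window clause holds on `(0, c n]`. [folklore] -/
theorem frontier_of_chain {c U L : ℕ → ℝ} {n : ℕ} (hn : 0 < n) (h0 : 0 < c 0) (hc0 : c 0 ≤ 2 / 3)
    (hmono : ∀ k, k < n → c k ≤ c (k + 1))
    (hU : ∀ k, k < n → weilGroundEnergy (c k) ≤ U k)
    (hL : ∀ k, k < n → ∀ g : ℝ → ℂ, IsWeilTest g →
      tsupport g ⊆ Icc (-(c (k + 1))) (c (k + 1)) → ∫ t, ‖g t‖ ^ 2 = (1 : ℝ) →
      (∀ t, g (-t) = -g t) → L (k + 1) ≤ (weilQuadratic g).re)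
    (hUL : ∀ k, k < n → U k < L (k + 1)) :
    ∀ a : ℝ, 0 < a → a ≤ c n → WeilWindowSimpleEven a := by
  intro a ha hb
  rcases le_or_gt a (2 / 3) with hle | hlt
  · exact weilWindowSimpleEven_of_le_two_thirds a ha hle
  · exact weilWindowSimpleEven_on_chain hn h0 hmono hU hL hUL (hc0.trans hlt.le) hb

/-- **Items 18085 / 1526 / 15432 after a chain**: with a certified chain from `c 0 ∈ (0, 2/3]` to
`c n ≥ 2/3`, `NoParityCrossing ↔ no parity tie beyond c n`, and no tie beyond `c n` gives all three
PF items. [folklore] -/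
theorem noParityCrossing_iff_beyond_chainTop {c U L : ℕ → ℝ} {n : ℕ} (hn : 0 < n) (h0 : 0 < c 0)
    (hc0 : c 0 ≤ 2 / 3) (hcn : 2 / 3 ≤ c n)
    (hmono : ∀ k, k < n → c k ≤ c (k + 1))
    (hU : ∀ k, k < n → weilGroundEnergy (c k) ≤ U k)
    (hL : ∀ k, k < n → ∀ g : ℝ → ℂ, IsWeilTest g →
      tsupport g ⊆ Icc (-(c (k + 1))) (c (k + 1)) → ∫ t, ‖g t‖ ^ 2 = (1 : ℝ) →
      (∀ t, g (-t) = -g t) → L (k + 1) ≤ (weilQuadratic g).re)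
    (hUL : ∀ k, k < n → U k < L (k + 1)) :
    (NoParityCrossing ↔ ∀ a : ℝ, c n < a → weilEvenGroundEnergy a ≠ weilOddGroundEnergy a) ∧
      ((∀ a : ℝ, c n < a → weilEvenGroundEnergy a ≠ weilOddGroundEnergy a) →
        NoParityCrossing ∧ GroundStateSimpleEven ∧ EvenWinsBeyondArch) :=
  ⟨noParityCrossing_iff_beyond_frontier hcn (frontier_of_chain hn h0 hc0 hmono hU hL hUL),
    parity_of_noTie_beyond_frontier hcn (frontier_of_chain hn h0 hc0 hmono hU hL hUL)⟩

/-! ## 4. The quantitative top of a chain: re-anchoring the continuous parity transport -/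

/-- A certified lower bound `L` on the odd window-`T` sphere bounds `ε_od(T)` from below
(`le_weilOddGroundEnergy_of_forall`, hypotheses in the cell-transfer order). [folklore] -/
theorem le_weilOddGroundEnergy_of_oddLower {T L : ℝ} (hT : 0 < T)
    (hL : ∀ g : ℝ → ℂ, IsWeilTest g → tsupport g ⊆ Icc (-T) T → ∫ t, ‖g t‖ ^ 2 = (1 : ℝ) →
      (∀ t, g (-t) = -g t) → L ≤ (weilQuadratic g).re) :
    L ≤ weilOddGroundEnergy T :=
  le_weilOddGroundEnergy_of_forall hT fun g hg hgs hodd hgn ↦ hL g hg hgs hgn hodd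

/-- Under the window clause at `T > 0` the full bottom IS the even bottom: `ε(T) = ε_ev(T)`
(`weilGroundEnergy_eq_min_even_odd`). [folklore] -/
theorem weilGroundEnergy_eq_even_of_weilWindowSimpleEven {T : ℝ} (hT : 0 < T)
    (h : WeilWindowSimpleEven T) : weilGroundEnergy T = weilEvenGroundEnergy T := by
  rw [weilGroundEnergy_eq_min_even_odd]
  exact min_eq_left ((weilWindowSimpleEven_iff_weilEvenGroundEnergy_lt hT).1 h).le

/-- **Splitting at the top of a certified cell ≥ its budget.**  On a certified cell `[b, T]`
(`0 < b ≤ T`, `ε(b) ≤ U < L ≤` odd window-`T` sphere): `ε_ev(T) ≤ U`, `L ≤ ε_od(T)`, hence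
`L − U ≤ ε_od(T) − ε_ev(T)`. [folklore] -/
theorem splitting_ge_budget_at_top {b T U L : ℝ} (hb : 0 < b) (hbT : b ≤ T) (hUL : U < L)
    (hU : weilGroundEnergy b ≤ U)
    (hL : ∀ g : ℝ → ℂ, IsWeilTest g → tsupport g ⊆ Icc (-T) T → ∫ t, ‖g t‖ ^ 2 = (1 : ℝ) →
      (∀ t, g (-t) = -g t) → L ≤ (weilQuadratic g).re) :
    weilEvenGroundEnergy T ≤ U ∧ L ≤ weilOddGroundEnergy T ∧
      L - U ≤ weilOddGroundEnergy T - weilEvenGroundEnergy T := by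
  have hT : 0 < T := hb.trans_le hbT
  have hev : weilEvenGroundEnergy T ≤ U := by
    rw [← weilGroundEnergy_eq_even_of_weilWindowSimpleEven hT
      (weilWindowSimpleEven_on_cell_of_le hb hUL hU hL hbT le_rfl)]
    exact (Summit.RiemannHypothesis.Cruxes.GronwallLeakage.Negative.weilGroundEnergy_antitone_of_pos
      hb hbT).trans hU
  have hod : L ≤ weilOddGroundEnergy T := le_weilOddGroundEnergy_of_oddLower hT hL
  exact ⟨hev, hod, by linarith⟩

/-- **Continuous parity transport (T-P) re-anchored at a frontier.**  If the window clause holds on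
`(0, T]` (`T > 0`; e.g. the top of a certified chain, `frontier_of_chain`) and the parity splitting
`Q = ε_od − ε_ev` has locally bounded relative leakage from `T` on (the Dini form of `Q' ≥ −K Q`,
as in `PfPersistenceParityTransport.splitting_pos_of_diniLeakageFrom`), then `ε_ev < ε_od` at EVERY
window `a > 0`. [folklore] -/
theorem lt_of_frontier_of_splittingLeakageFrom {T : ℝ} (hT0 : 0 < T)
    (hT : ∀ a : ℝ, 0 < a → a ≤ T → WeilWindowSimpleEven a)
    (hD : ∀ A : ℝ, T ≤ A → ∃ K : ℝ, ∀ x ∈ Ico T A, ∀ η δ : ℝ, 0 < η → 0 < δ →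
      ∃ h : ℝ, 0 < h ∧ h < δ ∧
        (weilOddGroundEnergy x - weilEvenGroundEnergy x) -
            (weilOddGroundEnergy (x + h) - weilEvenGroundEnergy (x + h)) ≤
          h * (K * (weilOddGroundEnergy x - weilEvenGroundEnergy x) + η)) :
    ∀ a : ℝ, 0 < a → weilEvenGroundEnergy a < weilOddGroundEnergy a := by
  intro a ha
  rcases le_or_gt a T with hle | hlt
  · exact lt_of_frontier hT ha hle
  · exact splitting_pos_of_diniLeakageFrom hT0 (lt_of_frontier hT hT0 le_rfl) hD a hlt.le

/-- **The three PF items from a frontier at `T ≥ 2/3` plus the splitting leakage from `T` on.**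
(T-P of TRANSPORT.md §4 with its typed input shortened to `[T, ∞)`: every certified chain shrinks
the range on which the rate hypothesis is needed.) [folklore] -/
theorem parity_of_frontier_of_splittingLeakageFrom {T : ℝ} (hT23 : 2 / 3 ≤ T)
    (hT : ∀ a : ℝ, 0 < a → a ≤ T → WeilWindowSimpleEven a)
    (hD : ∀ A : ℝ, T ≤ A → ∃ K : ℝ, ∀ x ∈ Ico T A, ∀ η δ : ℝ, 0 < η → 0 < δ →
      ∃ h : ℝ, 0 < h ∧ h < δ ∧
        (weilOddGroundEnergy x - weilEvenGroundEnergy x) -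
            (weilOddGroundEnergy (x + h) - weilEvenGroundEnergy (x + h)) ≤
          h * (K * (weilOddGroundEnergy x - weilEvenGroundEnergy x) + η)) :
    NoParityCrossing ∧ GroundStateSimpleEven ∧ EvenWinsBeyondArch :=
  parity_of_noTie_beyond_frontier hT23 hT fun a ha ↦
    ne_of_lt (lt_of_frontier_of_splittingLeakageFrom (lt_of_lt_of_le (by norm_num) hT23) hT hD a
      (lt_trans (lt_of_lt_of_le (by norm_num) hT23) ha))

end Summit.RiemannHypothesis.RiemannHypothesis.Theorems.PfPersistenceCellChain

end
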